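import Summits.ABC.IUTFork.Cor312LicenceShallowMultiSlot
import HarnessLib

/-!
# [IUTchIII] Cor. 3.12 — the (xi-f) LICENCE and branch C's hull-level antecedent at the sharp real settings in the
# TAME MULTI-SLOT regime (licence-level corollaries of `Cor312LicenceShallowMultiSlot`)

PROOF-ONLY record file (D-0012; 0 definitions, 0 `Prop` facts) of the abc-iut cell (WAVE-5 prover seat abc-iut-w5-d180,
gen 5; row «LICENCE-MULTISLOT-LOWER», second file). TAKES NO SIDE on [IUTchIII] Cor. 3.12 (S. Mochizuki, *Inter-universal
Teichmüller theory III*, kurims manuscript `paper:url-4b091feeb646`, Cor. 3.12 p. 173–174; Step (xi) (xi-f) p. 184 l. 26–27;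
Thm. 3.11 (i) (Ind2) p. 154) or on any author. The companion file proves the packet theorem
`qRegion_subset_thetaHull_settingDHVolSharp_of_tame_slots` (movers on ALL `j+1` capsule slots: at a tame prime the non-last
slots DONATE `ρ_p ≤ ‖ϖ_x‖^{1−e_x}` each); here the three licence-level corollaries:

* **`licence_settingDHVolSharp_of_tame_slots`** / **`licence_settingPrVolSharp_of_tame_slots`** — abc-iut-c312-1's
  `Thm311ToCor312.Licence` at abc-iut-c312-3's / abc-iut-c312-7's sharp real settings: Θ-ideles units off `S`; at every prime `p`
  under `S` a donation rate `ρ_p ≥ 1` with every place `x | p` tame (`p > 2`, `e_x ≤ p − 2`) and `ρ_p ≤ ‖p‖⁻¹·‖ϖ_x‖`; at every bad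
  `w | p` and label `j = i+1 ∈ 𝔽_l^⋇` either `‖t_{q,w}‖ ≤ ‖t_{Θ,j,w}‖` or `t_{Θ,j,w}` on a `p`-level `k` of `𝔪_w` with
  `‖t_{q,w}‖ ≤ ρ_p^{j}·‖p‖^k·‖ϖ_w‖`;
* **`exists_qPinned_and_hull_settingPrVolSharp_of_tame_slots`** — branch C's «∃ ρ qK, QPinned ∧ PilotKummerCompatHull» at
  `settingPrVolSharp` (any columns; integral q-ideles for the label `0`, via abc-iut-w5-d236's one-factor assembly there).

READING (neutral; numbers). `ρ_p = 1` is abc-iut-w5-d236's tame-levels theorem (p438095) on tame fibres; at a prime with a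
single tame place `w` (`‖t_Θ‖ = ‖ϖ‖^{m_Θ}`, `‖t_q‖ = ‖ϖ‖^{m_q}`) and `ρ_p = ‖ϖ‖^{1−e}` the window reads
`m_q ≥ e·⌈m_Θ/e⌉ − (j+1)(e−1)`, against abc-iut-w4-d026's upper leg «refuted when `m_q < e·⌊m_Θ/e⌋ − (j+1)(e−1)`» — an exact
per-datum tame dichotomy when `e ∣ m_Θ`. Example: `ℚ(√7)` (`RamifiedMover.F7`/`v7`, `e = 2`, `p = 7`), `l = 5`, realising
`ord(t_q) = 1`, `ord(t_{Θ,2}) = 4`: inhabited (`1 ≥ 4 − 3`), outside the one-factor window (`4 > 2`).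

HONEST SCOPE. OUR typed sharp containers (Θ-regions constant in `m`) and Dupuy–Hilado's typed (Ind1)/(Ind2) (`logShellsDH`;
(Ind2) independent per capsule slot and place, as abc-iut-c312-1 typed Thm. 3.11 (i)); STRONGER-THAN-PRINT hull reading
(ADJUDICATION-SPEC §2 (G1′)); nothing about the printed GLOBAL inequality, the author's intended hull, or the M-level `Ism`;
nothing asserts or refutes [IUTchIII] Cor. 3.12. [cite: Mochizuki2012, IUTchIII Cor. 3.12 p.173–175, Thm. 3.11 (i) p.154, Step
(xi) p.184] [cite: DupuyHilado2025, §3.9, §4.7, §4.9] [claim: Mochizuki2012, status: disputed] for every IUT sentence quoted.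
typed ≠ proved; instantiated ≠ endorsed.
-/

noncomputable section

open Set Function
open scoped Pointwise

namespace Summit.ABC.IUTFork.Thm311.Real

open Cor312 Cor312.Setting Cor312Vol Literature.IUT.LogThetaLattice Literature.IUT.LogVolume NumberField IsDedekindDomain
open Literature.NumberTheory.NumberFields Literature.NumberTheory.GaloisRepresentations.Ultrametric

variable {F : Type} [Field F] [NumberField F] (X : PilotData F) {logv : PadicLogs F} (hlog : LogvAnalytic logv)
  (M : Type) [Field M] [NumberField M]
  (archPk : ∀ (j : (thetaIndex X).Label) (vQ : (thetaIndex X).VQ), Set ((logShellsDH X logv).Packet j vQ))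
  (archSub : ∀ (j : (thetaIndex X).Label) (v : (thetaIndex X).V),
    Set ((logShellsDH X logv).Packet j ((thetaIndex X).over v)))
  (Ψ : ℤ → ∀ v : (thetaIndex X).V, v ∈ (thetaIndex X).Vbad → Set ((logShellsDH X logv).StarPacket v))
  (act : ℤ → ∀ v : (thetaIndex X).V, v ∈ (thetaIndex X).Vbad →
    (logShellsDH X logv).StarPacket v → Module.End ℚ ((logShellsDH X logv).StarPacket v))
  (Mmod : ℤ → ∀ j : (thetaIndex X).LabelStar, Set ((logShellsDH X logv).GlobalPacket j.1))
  (region : ℤ → ∀ j : (thetaIndex X).LabelStar, FinDivisor M → ∀ vQ : (thetaIndex X).VQ,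
    Set ((logShellsDH X logv).Packet j.1 vQ))
  (n : ℤ) {HT : Type} {LogLink : HT → HT → Type} {IsFull : ∀ {s t : HT}, LogLink s t → Prop}
  (lat : LGPGaussianLogThetaLattice LogLink IsFull)
  {Frd : Type} {IsoF : Frd → Frd → Type} {Ob : Frd → Type} {realify : Frd → Frd} {Strip : Type}
  {IsoS : Strip → Strip → Type} {Mv : ∀ v : (thetaIndex X).V, v ∈ (thetaIndex X).Vbad → Type}
  [∀ v h, Monoid (Mv v h)]
  (sig : GlobalLGPFrobenioidSignature (thetaIndex X).lstar (thetaIndex X).V (· ∈ (thetaIndex X).Vbad)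
    Frd IsoF Ob realify Strip IsoS Mv)
  (split : SplittingMonoids Mv) {ObΔ : Type} {N : ∀ v : (thetaIndex X).V, v ∈ (thetaIndex X).Vbad → Type}
  [∀ v h, Monoid (N v h)] (qData : QPilotData ObΔ N)
  (tq : ∀ (pp : Nat.Primes) (x : (thetaIndex X).Fibre (.inr pp)), haveI : Fact (pp : ℕ).Prime := ⟨pp.2⟩; kOf X pp.1 x)
  (t : ∀ (pp : Nat.Primes) (_ : Fin X.lstar) (x : (thetaIndex X).Fibre (.inr pp)),
    haveI : Fact (pp : ℕ).Prime := ⟨pp.2⟩; kOf X pp.1 x)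
  (htq0 : ∀ pp x, tq pp x ≠ 0)
  (htq1 : ∀ (pp : Nat.Primes) (x : (thetaIndex X).Fibre (.inr pp)),
    haveI : Fact (pp : ℕ).Prime := ⟨pp.2⟩; placeOf X pp.1 x ∉ X.S → ‖tq pp x‖ = 1)
  (col : ℤ → Column (logShellsDH X logv))

/-! ## 5. The licence and branch C's antecedent in the tame multi-slot regime -/

/-- **THE (xi-f) LICENCE AT `settingDHVolSharp` IN THE TAME MULTI-SLOT REGIME.** Θ-ideles units off `S`; at every prime `p` UNDER
`S`: a donation rate `ρ_p ≥ 1` such that every place `x | p` is tame (`p > 2`, `e_x ≤ p − 2`) with `ρ_p ≤ ‖p‖⁻¹·‖ϖ_x‖`; and at every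
BAD place `w | p` and label `j = i+1 ∈ 𝔽_l^⋇`: either `‖t_{q,w}‖ ≤ ‖t_{Θ,j,w}‖`, or `t_{Θ,j,w}` lies on a `p`-level `k` of `𝔪_w` with
`‖t_{q,w}‖ ≤ ρ_p^{j}·‖p‖^k·‖ϖ_w‖`. THEN abc-iut-c312-1's `Thm311ToCor312.Licence` holds at abc-iut-c312-3's sharp real setting.
(`ρ_p = 1`: abc-iut-w5-d236's `licence_settingDHVolSharp_of_tame_levels` restricted to tame fibres; `ρ_p = ‖ϖ‖^{1−e}` at a prime
with a single place: the window `m_q ≥ e·⌈m_Θ/e⌉ − (j+1)(e−1)` in orders.) [cite: DupuyHilado2025, §3.9, §4.9]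
[cite: WeilBNT1967, Ch. II §2, Th. 1] [claim: Mochizuki2012, status: disputed] -/
theorem licence_settingDHVolSharp_of_tame_slots (ρ : Nat.Primes → ℝ) (hρ1 : ∀ pp, 1 ≤ ρ pp)
    (ht1 : ∀ (pp : Nat.Primes) (i : Fin X.lstar) (x : (thetaIndex X).Fibre (.inr pp)),
      haveI : Fact (pp : ℕ).Prime := ⟨pp.2⟩; placeOf X pp.1 x ∉ X.S → ‖t pp i x‖ = 1)
    (hρ : ∀ (pp : Nat.Primes) (x : (thetaIndex X).Fibre (.inr pp)),
      haveI : Fact (pp : ℕ).Prime := ⟨pp.2⟩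
      (∃ w : (thetaIndex X).Fibre (.inr pp), placeOf X pp.1 w ∈ X.S) →
        2 < (pp : ℕ) ∧ (placeOf X pp.1 x).asIdeal.ramificationIdx ℤ ≤ (pp : ℕ) - 2 ∧
          ∃ ϖ : (kOf X pp.1 x)ˣ, IsUniformizer ϖ ∧ ρ pp ≤ ‖(pp : ℚ_[pp])‖⁻¹ * ‖(ϖ : kOf X pp.1 x)‖)
    (hwin : ∀ (pp : Nat.Primes) (i : Fin (thetaIndex X).lstar) (w : (thetaIndex X).Fibre (.inr pp)),
      haveI : Fact (pp : ℕ).Prime := ⟨pp.2⟩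
      placeOf X pp.1 w ∈ X.S →
        ‖tq pp w‖ ≤ ‖t pp i w‖ ∨
          ∃ (ϖ : (kOf X pp.1 w)ˣ) (k : ℤ), IsUniformizer ϖ ∧
            ‖(pp : ℚ_[pp])‖ * (‖(pp : ℚ_[pp])‖ ^ k * ‖(ϖ : kOf X pp.1 w)‖) < ‖t pp i w‖ ∧
            ‖t pp i w‖ ≤ ‖(pp : ℚ_[pp])‖ ^ k * ‖(ϖ : kOf X pp.1 w)‖ ∧
            ‖tq pp w‖ ≤ ρ pp ^ ((i : ℕ) + 1) * (‖(pp : ℚ_[pp])‖ ^ k * ‖(ϖ : kOf X pp.1 w)‖)) :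
    Thm311ToCor312.Licence (settingDHVolSharp X hlog M archPk archSub Ψ act Mmod region n lat sig split qData tq t htq0 htq1) := by
  intro i vQ
  cases vQ with
  | inl u =>
    exact qRegion_subset_thetaHull_settingDHVolSharp_inl X hlog M archPk archSub Ψ act Mmod region n lat sig split qData tq t htq0
      htq1 (labelSucc i) u
  | inr pp =>
    haveI : Fact (pp : ℕ).Prime := ⟨pp.2⟩
    by_cases hS : ∃ w : (thetaIndex X).Fibre (.inr pp), placeOf X pp.1 w ∈ X.S
    · refine qRegion_subset_thetaHull_settingDHVolSharp_of_tame_slots X hlog M archPk archSub Ψ act Mmod region n lat sig split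
        qData tq t htq0 htq1 i pp (ρ pp) (hρ1 pp) (fun x => hρ pp x hS) fun w => ?_
      by_cases hw : placeOf X pp.1 w ∈ X.S
      · exact hwin pp i w hw
      · exact Or.inl (by rw [ht1 pp i w hw, htq1 pp w hw])
    · exact qRegion_subset_thetaHull_settingDHVolSharp_of_forall_not_mem X hlog M archPk archSub Ψ act Mmod region n lat sig split
        qData tq t htq0 htq1 i pp ht1 fun w hw => hS ⟨w, hw⟩

/-- **The same at the print-normalised sharp setting `settingPrVolSharp`** (abc-iut-c312-7; same regions, frames and
indeterminacies — `licence_settingPrVolSharp_iff_settingDHVolSharp`). [claim: Mochizuki2012, status: disputed] -/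
theorem licence_settingPrVolSharp_of_tame_slots (ρ : Nat.Primes → ℝ) (hρ1 : ∀ pp, 1 ≤ ρ pp)
    (ht1 : ∀ (pp : Nat.Primes) (i : Fin X.lstar) (x : (thetaIndex X).Fibre (.inr pp)),
      haveI : Fact (pp : ℕ).Prime := ⟨pp.2⟩; placeOf X pp.1 x ∉ X.S → ‖t pp i x‖ = 1)
    (hρ : ∀ (pp : Nat.Primes) (x : (thetaIndex X).Fibre (.inr pp)),
      haveI : Fact (pp : ℕ).Prime := ⟨pp.2⟩
      (∃ w : (thetaIndex X).Fibre (.inr pp), placeOf X pp.1 w ∈ X.S) →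
        2 < (pp : ℕ) ∧ (placeOf X pp.1 x).asIdeal.ramificationIdx ℤ ≤ (pp : ℕ) - 2 ∧
          ∃ ϖ : (kOf X pp.1 x)ˣ, IsUniformizer ϖ ∧ ρ pp ≤ ‖(pp : ℚ_[pp])‖⁻¹ * ‖(ϖ : kOf X pp.1 x)‖)
    (hwin : ∀ (pp : Nat.Primes) (i : Fin (thetaIndex X).lstar) (w : (thetaIndex X).Fibre (.inr pp)),
      haveI : Fact (pp : ℕ).Prime := ⟨pp.2⟩
      placeOf X pp.1 w ∈ X.S →
        ‖tq pp w‖ ≤ ‖t pp i w‖ ∨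
          ∃ (ϖ : (kOf X pp.1 w)ˣ) (k : ℤ), IsUniformizer ϖ ∧
            ‖(pp : ℚ_[pp])‖ * (‖(pp : ℚ_[pp])‖ ^ k * ‖(ϖ : kOf X pp.1 w)‖) < ‖t pp i w‖ ∧
            ‖t pp i w‖ ≤ ‖(pp : ℚ_[pp])‖ ^ k * ‖(ϖ : kOf X pp.1 w)‖ ∧
            ‖tq pp w‖ ≤ ρ pp ^ ((i : ℕ) + 1) * (‖(pp : ℚ_[pp])‖ ^ k * ‖(ϖ : kOf X pp.1 w)‖)) :
    Thm311ToCor312.Licence (settingPrVolSharp X hlog M archPk archSub Ψ act Mmod region n lat sig split qData tq t htq0 htq1) := by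
  rw [licence_settingPrVolSharp_iff_settingDHVolSharp]
  exact licence_settingDHVolSharp_of_tame_slots X hlog M archPk archSub Ψ act Mmod region n lat sig split qData tq t htq0 htq1 ρ hρ1
    ht1 hρ hwin

/-- **BRANCH C's HULL-LEVEL ANTECEDENT «∃ ρ qK, QPinned ∧ PilotKummerCompatHull» IS INHABITED at `settingPrVolSharp` in the tame
multi-slot regime** (any columns `col`; integral q-ideles for the label `0`, where the Θ-idele is `1`). With C-cert-1's
`thetaSide_of_exists_qPinned_and_hull_settingPrVolSharp` the typed Θ-side inequality follows there.
[cite: DupuyHilado2025, §3.9, §4.9] [cite: WeilBNT1967, Ch. II §2, Th. 1] [claim: Mochizuki2012, status: disputed] -/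
theorem exists_qPinned_and_hull_settingPrVolSharp_of_tame_slots (htqle : ∀ pp x, ‖tq pp x‖ ≤ 1)
    (ρ : Nat.Primes → ℝ) (hρ1 : ∀ pp, 1 ≤ ρ pp)
    (ht1 : ∀ (pp : Nat.Primes) (i : Fin X.lstar) (x : (thetaIndex X).Fibre (.inr pp)),
      haveI : Fact (pp : ℕ).Prime := ⟨pp.2⟩; placeOf X pp.1 x ∉ X.S → ‖t pp i x‖ = 1)
    (hρ : ∀ (pp : Nat.Primes) (x : (thetaIndex X).Fibre (.inr pp)),
      haveI : Fact (pp : ℕ).Prime := ⟨pp.2⟩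
      (∃ w : (thetaIndex X).Fibre (.inr pp), placeOf X pp.1 w ∈ X.S) →
        2 < (pp : ℕ) ∧ (placeOf X pp.1 x).asIdeal.ramificationIdx ℤ ≤ (pp : ℕ) - 2 ∧
          ∃ ϖ : (kOf X pp.1 x)ˣ, IsUniformizer ϖ ∧ ρ pp ≤ ‖(pp : ℚ_[pp])‖⁻¹ * ‖(ϖ : kOf X pp.1 x)‖)
    (hwin : ∀ (pp : Nat.Primes) (i : Fin (thetaIndex X).lstar) (w : (thetaIndex X).Fibre (.inr pp)),
      haveI : Fact (pp : ℕ).Prime := ⟨pp.2⟩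
      placeOf X pp.1 w ∈ X.S →
        ‖tq pp w‖ ≤ ‖t pp i w‖ ∨
          ∃ (ϖ : (kOf X pp.1 w)ˣ) (k : ℤ), IsUniformizer ϖ ∧
            ‖(pp : ℚ_[pp])‖ * (‖(pp : ℚ_[pp])‖ ^ k * ‖(ϖ : kOf X pp.1 w)‖) < ‖t pp i w‖ ∧
            ‖t pp i w‖ ≤ ‖(pp : ℚ_[pp])‖ ^ k * ‖(ϖ : kOf X pp.1 w)‖ ∧
            ‖tq pp w‖ ≤ ρ pp ^ ((i : ℕ) + 1) * (‖(pp : ℚ_[pp])‖ ^ k * ‖(ϖ : kOf X pp.1 w)‖)) :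
    ∃ (ρ' : (∀ v : (thetaIndex X).V, v ∈ (thetaIndex X).Vbad → Set ((logShellsDH X logv).StarPacket v)) →
          ∀ (j : (thetaIndex X).Label) (vQ : (thetaIndex X).VQ), Set ((logShellsDH X logv).Packet j vQ))
        (qK : ∀ v : (thetaIndex X).V, v ∈ (thetaIndex X).Vbad → Set ((logShellsDH X logv).StarPacket v)),
        QPinned ({ toSituation := situationPrVol X hlog M archPk archSub Ψ act Mmod region, col := col } :
            LatticeSituation (thetaIndex X))
          (settingPrVolSharp X hlog M archPk archSub Ψ act Mmod region n lat sig split qData tq t htq0 htq1) ρ' qK ∧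
        PilotKummerCompatHull ({ toSituation := situationPrVol X hlog M archPk archSub Ψ act Mmod region, col := col } :
            LatticeSituation (thetaIndex X))
          (settingPrVolSharp X hlog M archPk archSub Ψ act Mmod region n lat sig split qData tq t htq0 htq1) ρ' qK := by
  refine (Conditional.Antecedent.exists_qPinned_and_hull_iff
    ({ toSituation := situationPrVol X hlog M archPk archSub Ψ act Mmod region, col := col } : LatticeSituation (thetaIndex X))
    (settingPrVolSharp X hlog M archPk archSub Ψ act Mmod region n lat sig split qData tq t htq0 htq1)).2 fun j vQ => ?_
  by_cases hj : 0 < (j : ℕ)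
  · -- a label of `𝔽_l^⋇`
    have hj' : j = labelSucc ⟨(j : ℕ) - 1, by have := j.2; simp only [thetaIndex] at this ⊢; omega⟩ := by
      ext; simp only [labelSucc, Fin.val_succ]; omega
    rw [hj']
    exact licence_settingDHVolSharp_of_tame_slots X hlog M archPk archSub Ψ act Mmod region n lat sig split qData tq t htq0 htq1 ρ hρ1
      ht1 hρ hwin _ vQ
  · -- the label `0`: `labelIdele = 1`, the identity movers (one-factor assembly of abc-iut-w5-d236)
    refine qRegion_subset_thetaHull_settingDHVolSharp_of_movers X hlog M archPk archSub Ψ act Mmod region n lat sig split qData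
      tq t htq0 htq1 j vQ fun pp x => exists_mover_of_norm_le X hlog tq t pp j x ?_
    haveI : Fact (pp : ℕ).Prime := ⟨pp.2⟩
    unfold labelIdele
    rw [dif_neg hj, norm_one]
    exact htqle pp x

/-! ## 6. The window in ORDERS at a prime with uniformly ramified tame fibre: `m_q ≥ e·⌈m_Θ/e⌉ − (j+1)(e−1)` -/

/-- **THE TAME MULTI-SLOT WINDOW IN ORDERS** at the packet `(i+1, p)`, `j = i+1`: `p > 2`, every place over `p` with the SAME
ramification index `e ≤ p − 2` (e.g. a single place over `p`), uniformizers `ϖ_x`; at every `w | p` either `‖t_{q,w}‖ ≤ ‖t_{Θ,j,w}‖` or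
`‖t_{Θ,j,w}‖ = ‖ϖ_w‖^{m_Θ}`, `‖t_{q,w}‖ = ‖ϖ_w‖^{m_q}` with `m_Θ ≥ 1` and **`e·⌊(m_Θ−1)/e⌋ + 1 − j·(e−1) ≤ m_q`** (`= e·⌈m_Θ/e⌉ − (j+1)(e−1)`):
THEN the q-pilot region at `(j, p)` lies in `ⁿ˒°𝒰_{j,p}`. The last slot reaches the top `‖ϖ‖^{e⌊(m_Θ−1)/e⌋+1}` of the `p`-level of
`t_Θ`, the `j` non-last slots donate `e − 1` orders each (donation rate `ρ = p·p^{−1/e} = ‖ϖ‖^{1−e}`). For realising ideles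
`m_Θ = j²·m_q`. Compare abc-iut-w4-d026's UPPER leg «refuted when `m_q < e·⌊m_Θ/e⌋ − (j+1)(e−1)`»: exact complement when `e ∣ m_Θ`.
[cite: DupuyHilado2025, §3.9, §4.9] [cite: WeilBNT1967, Ch. II §2, Th. 1] [claim: Mochizuki2012, status: disputed] -/
theorem qRegion_subset_thetaHull_settingDHVolSharp_of_tame_orders (i : Fin (thetaIndex X).lstar) (pp : Nat.Primes)
    (hp2 : 2 < (pp : ℕ)) (e : ℕ) (hep : e ≤ (pp : ℕ) - 2)
    (ϖ : haveI : Fact (pp : ℕ).Prime := ⟨pp.2⟩; ∀ x : (thetaIndex X).Fibre (.inr pp), (kOf X pp.1 x)ˣ)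
    (hfib : haveI : Fact (pp : ℕ).Prime := ⟨pp.2⟩
      ∀ x : (thetaIndex X).Fibre (.inr pp), (placeOf X pp.1 x).asIdeal.ramificationIdx ℤ = e ∧ IsUniformizer (ϖ x))
    (hord : haveI : Fact (pp : ℕ).Prime := ⟨pp.2⟩
      ∀ w : (thetaIndex X).Fibre (.inr pp),
        ‖tq pp w‖ ≤ ‖t pp i w‖ ∨
          ∃ mΘ mq : ℤ, ‖t pp i w‖ = ‖(ϖ w : kOf X pp.1 w)‖ ^ mΘ ∧ ‖tq pp w‖ = ‖(ϖ w : kOf X pp.1 w)‖ ^ mq ∧ 1 ≤ mΘ ∧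
            (e : ℤ) * ((mΘ - 1) / e) + 1 - ((i : ℕ) + 1 : ℕ) * ((e : ℤ) - 1) ≤ mq) :
    (settingDHVolSharp X hlog M archPk archSub Ψ act Mmod region n lat sig split qData tq t htq0 htq1).qRegion
        (labelSucc i) (.inr pp) ⊆
      (settingDHVolSharp X hlog M archPk archSub Ψ act Mmod region n lat sig split qData tq t htq0 htq1).thetaHull
        (labelSucc i) (.inr pp) := by
  haveI hF : Fact (pp : ℕ).Prime := ⟨pp.2⟩
  have hp1 : (1 : ℝ) ≤ (pp : ℕ) := by exact_mod_cast pp.2.one_lt.le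
  have hp0 : (0 : ℝ) < (pp : ℕ) := by positivity
  -- the invariants at a place over `p`: `e_K = e`, `‖ϖ_x‖ = p^{-1/e}`, `‖ϖ_x‖^e = p⁻¹`
  have heK : ∀ x : (thetaIndex X).Fibre (.inr pp), absRamificationIdx (pp : ℕ) (kOf X pp.1 x) = e := fun x =>
    (absRamificationIdx_rescaledCompletion F (pp : ℕ) (placeOf X pp.1 x) (natCast_mem_placeOf X pp.1 x)).trans (hfib x).1
  have he0 : 0 < e := by
    rw [← heK (Classical.arbitrary _)]
    exact absRamificationIdx_pos _ _
  -- donation rate `ρ = p · p^{-1/e}`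
  set ρ : ℝ := ((pp : ℕ) : ℝ) * ((pp : ℕ) : ℝ) ^ (-(1 / (e : ℝ))) with hρ
  have hnormϖ : ∀ x : (thetaIndex X).Fibre (.inr pp), ‖(ϖ x : kOf X pp.1 x)‖ = ((pp : ℕ) : ℝ) ^ (-(1 / (e : ℝ))) := by
    intro x
    rw [norm_eq_rpow_of_isUniformizer (pp : ℕ) (kOf X pp.1 x) (hfib x).2, heK x]
  have hρ1 : 1 ≤ ρ := by
    have h : ((pp : ℕ) : ℝ) ^ (-(1 : ℝ)) ≤ ((pp : ℕ) : ℝ) ^ (-(1 / (e : ℝ))) := by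
      refine Real.rpow_le_rpow_of_exponent_le hp1 (neg_le_neg ?_)
      rw [div_le_one (by exact_mod_cast he0)]
      exact_mod_cast he0
    calc (1 : ℝ) = ((pp : ℕ) : ℝ) * ((pp : ℕ) : ℝ) ^ (-(1 : ℝ)) := by
          rw [Real.rpow_neg_one, mul_inv_cancel₀ hp0.ne']
      _ ≤ ρ := mul_le_mul_of_nonneg_left h hp0.le
  refine qRegion_subset_thetaHull_settingDHVolSharp_of_tame_slots X hlog M archPk archSub Ψ act Mmod region n lat sig split qData
    tq t htq0 htq1 i pp ρ hρ1 (fun x => ⟨hp2, (hfib x).1.le.trans hep, ϖ x, (hfib x).2, le_of_eq ?_⟩) fun w => ?_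
  · -- `ρ = ‖p‖⁻¹ · ‖ϖ_x‖`
    rw [hnormϖ x, Padic.norm_p, inv_inv]
  · rcases hord w with h | ⟨mΘ, mq, hΘ, hq, h1, hle⟩
    · exact Or.inl h
    · right
      set a : ℝ := ‖(ϖ w : kOf X pp.1 w)‖ with ha
      have ha0 : 0 < a := norm_pos_iff.2 (ϖ w).ne_zero
      have ha1 : a < 1 := (hfib w).2.norm_lt_one
      have hae : a ^ e = ((pp : ℕ) : ℝ)⁻¹ := by rw [ha, ← heK w]; exact norm_pow_absRamificationIdx (pp : ℕ) _ (hfib w).2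
      have hpnorm : ‖((pp : ℕ) : ℚ_[pp])‖ = a ^ (e : ℤ) := by rw [Padic.norm_p, zpow_natCast, hae]
      have hρa : ρ = a ^ (1 - (e : ℤ)) := by
        rw [zpow_sub₀ ha0.ne', zpow_one, zpow_natCast, hae, div_inv_eq_mul, hρ, ← hnormϖ w, ← ha, mul_comm]
      -- the `p`-level of `t_Θ`: `k = ⌊(m_Θ − 1)/e⌋`
      set k : ℤ := (mΘ - 1) / e with hk
      have hediv : (e : ℤ) * k ≤ mΘ - 1 := Int.mul_ediv_self_le (by exact_mod_cast he0.ne')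
      have hemod : mΘ - 1 < (e : ℤ) * k + e := Int.lt_mul_ediv_self_add (by exact_mod_cast he0)
      have hzle : ∀ A B : ℤ, a ^ A ≤ a ^ B ↔ B ≤ A := fun A B => zpow_le_zpow_iff_right_of_lt_one₀ ha0 ha1
      have hzlt : ∀ A B : ℤ, a ^ A < a ^ B ↔ B < A := fun A B => zpow_lt_zpow_iff_right_of_lt_one₀ ha0 ha1
      refine ⟨ϖ w, k, (hfib w).2, ?_, ?_, ?_⟩
      · -- `‖p‖·(‖p‖^k·‖ϖ‖) < ‖t_Θ‖`
        rw [hΘ, hpnorm, ← zpow_mul, ← ha, ← zpow_add_one₀ ha0.ne', ← zpow_add₀ ha0.ne', hzlt]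
        linarith
      · -- `‖t_Θ‖ ≤ ‖p‖^k·‖ϖ‖`
        rw [hΘ, hpnorm, ← zpow_mul, ← ha, ← zpow_add_one₀ ha0.ne', hzle]
        linarith
      · -- `‖t_q‖ ≤ ρ^{i+1}·(‖p‖^k·‖ϖ‖)`
        rw [hq, hpnorm, hρa, ← zpow_mul, ← ha, ← zpow_add_one₀ ha0.ne', ← zpow_natCast, ← zpow_mul,
          ← zpow_add₀ ha0.ne', hzle]
        push_cast at hle ⊢
        linarith

/-- **THE (xi-f) LICENCE AT `settingDHVolSharp` IN ORDERS (uniformly ramified tame fibres).** Θ-ideles units off `S`; a ramification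
index `e_p` and uniformizers `ϖ_x` at every prime `p` UNDER `S`, where `p > 2`, every place `x | p` has `e_x = e_p ≤ p − 2`; and at every
bad `w | p` and label `j = i+1 ∈ 𝔽_l^⋇`: `‖t_{q,w}‖ ≤ ‖t_{Θ,j,w}‖`, or `‖t_{Θ,j,w}‖ = ‖ϖ_w‖^{m_Θ}`, `‖t_{q,w}‖ = ‖ϖ_w‖^{m_q}`, `m_Θ ≥ 1`,
**`e_p·⌊(m_Θ−1)/e_p⌋ + 1 − j·(e_p−1) ≤ m_q`**. THEN abc-iut-c312-1's `Thm311ToCor312.Licence` holds at abc-iut-c312-3's sharp real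
setting (realising ideles: `m_Θ = j²·m_q`). [cite: DupuyHilado2025, §3.9, §4.9] [cite: WeilBNT1967, Ch. II §2, Th. 1]
[claim: Mochizuki2012, status: disputed] -/
theorem licence_settingDHVolSharp_of_tame_orders
    (ht1 : ∀ (pp : Nat.Primes) (i : Fin X.lstar) (x : (thetaIndex X).Fibre (.inr pp)),
      haveI : Fact (pp : ℕ).Prime := ⟨pp.2⟩; placeOf X pp.1 x ∉ X.S → ‖t pp i x‖ = 1)
    (e : Nat.Primes → ℕ)
    (ϖ : ∀ (pp : Nat.Primes) (x : (thetaIndex X).Fibre (.inr pp)), haveI : Fact (pp : ℕ).Prime := ⟨pp.2⟩; (kOf X pp.1 x)ˣ)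
    (hfib : ∀ (pp : Nat.Primes) (x : (thetaIndex X).Fibre (.inr pp)),
      haveI : Fact (pp : ℕ).Prime := ⟨pp.2⟩
      (∃ w : (thetaIndex X).Fibre (.inr pp), placeOf X pp.1 w ∈ X.S) →
        2 < (pp : ℕ) ∧ e pp ≤ (pp : ℕ) - 2 ∧ (placeOf X pp.1 x).asIdeal.ramificationIdx ℤ = e pp ∧ IsUniformizer (ϖ pp x))
    (hord : ∀ (pp : Nat.Primes) (i : Fin (thetaIndex X).lstar) (w : (thetaIndex X).Fibre (.inr pp)),
      haveI : Fact (pp : ℕ).Prime := ⟨pp.2⟩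
      placeOf X pp.1 w ∈ X.S →
        ‖tq pp w‖ ≤ ‖t pp i w‖ ∨
          ∃ mΘ mq : ℤ, ‖t pp i w‖ = ‖(ϖ pp w : kOf X pp.1 w)‖ ^ mΘ ∧ ‖tq pp w‖ = ‖(ϖ pp w : kOf X pp.1 w)‖ ^ mq ∧ 1 ≤ mΘ ∧
            (e pp : ℤ) * ((mΘ - 1) / e pp) + 1 - ((i : ℕ) + 1 : ℕ) * ((e pp : ℤ) - 1) ≤ mq) :
    Thm311ToCor312.Licence (settingDHVolSharp X hlog M archPk archSub Ψ act Mmod region n lat sig split qData tq t htq0 htq1) := by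
  intro i vQ
  cases vQ with
  | inl u =>
    exact qRegion_subset_thetaHull_settingDHVolSharp_inl X hlog M archPk archSub Ψ act Mmod region n lat sig split qData tq t htq0
      htq1 (labelSucc i) u
  | inr pp =>
    haveI : Fact (pp : ℕ).Prime := ⟨pp.2⟩
    by_cases hS : ∃ w : (thetaIndex X).Fibre (.inr pp), placeOf X pp.1 w ∈ X.S
    · obtain ⟨hp2, hep, -⟩ := hfib pp (Classical.arbitrary _) hS
      refine qRegion_subset_thetaHull_settingDHVolSharp_of_tame_orders X hlog M archPk archSub Ψ act Mmod region n lat sig split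
        qData tq t htq0 htq1 i pp hp2 (e pp) hep (ϖ pp) (fun x => ⟨(hfib pp x hS).2.2.1, (hfib pp x hS).2.2.2⟩) fun w => ?_
      by_cases hw : placeOf X pp.1 w ∈ X.S
      · exact hord pp i w hw
      · exact Or.inl (by rw [ht1 pp i w hw, htq1 pp w hw])
    · exact qRegion_subset_thetaHull_settingDHVolSharp_of_forall_not_mem X hlog M archPk archSub Ψ act Mmod region n lat sig split
        qData tq t htq0 htq1 i pp ht1 fun w hw => hS ⟨w, hw⟩

/-- **The same at `settingPrVolSharp`.** [claim: Mochizuki2012, status: disputed] -/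
theorem licence_settingPrVolSharp_of_tame_orders
    (ht1 : ∀ (pp : Nat.Primes) (i : Fin X.lstar) (x : (thetaIndex X).Fibre (.inr pp)),
      haveI : Fact (pp : ℕ).Prime := ⟨pp.2⟩; placeOf X pp.1 x ∉ X.S → ‖t pp i x‖ = 1)
    (e : Nat.Primes → ℕ)
    (ϖ : ∀ (pp : Nat.Primes) (x : (thetaIndex X).Fibre (.inr pp)), haveI : Fact (pp : ℕ).Prime := ⟨pp.2⟩; (kOf X pp.1 x)ˣ)
    (hfib : ∀ (pp : Nat.Primes) (x : (thetaIndex X).Fibre (.inr pp)),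
      haveI : Fact (pp : ℕ).Prime := ⟨pp.2⟩
      (∃ w : (thetaIndex X).Fibre (.inr pp), placeOf X pp.1 w ∈ X.S) →
        2 < (pp : ℕ) ∧ e pp ≤ (pp : ℕ) - 2 ∧ (placeOf X pp.1 x).asIdeal.ramificationIdx ℤ = e pp ∧ IsUniformizer (ϖ pp x))
    (hord : ∀ (pp : Nat.Primes) (i : Fin (thetaIndex X).lstar) (w : (thetaIndex X).Fibre (.inr pp)),
      haveI : Fact (pp : ℕ).Prime := ⟨pp.2⟩
      placeOf X pp.1 w ∈ X.S →
        ‖tq pp w‖ ≤ ‖t pp i w‖ ∨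
          ∃ mΘ mq : ℤ, ‖t pp i w‖ = ‖(ϖ pp w : kOf X pp.1 w)‖ ^ mΘ ∧ ‖tq pp w‖ = ‖(ϖ pp w : kOf X pp.1 w)‖ ^ mq ∧ 1 ≤ mΘ ∧
            (e pp : ℤ) * ((mΘ - 1) / e pp) + 1 - ((i : ℕ) + 1 : ℕ) * ((e pp : ℤ) - 1) ≤ mq) :
    Thm311ToCor312.Licence (settingPrVolSharp X hlog M archPk archSub Ψ act Mmod region n lat sig split qData tq t htq0 htq1) := by
  rw [licence_settingPrVolSharp_iff_settingDHVolSharp]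
  exact licence_settingDHVolSharp_of_tame_orders X hlog M archPk archSub Ψ act Mmod region n lat sig split qData tq t htq0 htq1 ht1 e
    ϖ hfib hord

end Summit.ABC.IUTFork.Thm311.Real

end
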